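import Summits.CriticalPhenomena.PercolationContinuityZ3.Theorems.PercNearOneGluingNoHeavyQuantCombCountLaw
import HarnessLib

/-!
# QUANT lane R8 — counts of independent events: WINDOW probabilities `P(s ≤ # ≤ t)` obey "no rise after a fall"

builds on p205010 (kernel theorem, internal audit signed; external expert review pending)

Support file (`--supports stmt-CriticalPhenomena-4575`), census seat prim-quant-census-1 (gen 9); memo
`prim-quant-census-1/MOVES-AND-TRANSPORT-G9.md` §4.  The comb theorem (LEAD-NOTES-G9 N20, `…QuantCombCountLaw.lean`) relocates UNIT
hairs via the unimodality of `k ↦ P(C_k = j)` (`Quant.indepEvents_law_noRise`); a BLOB hair of size `a` needs the same for the WINDOW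
`k ↦ P(j+1−a ≤ C_k ≤ j)`.  Same vocabulary (`prodBernoulli q`, witnesses `z : κ` with pairwise disjoint gate sets `Q z`,
`N_Z = #{z ∈ Z | Q z open}`, `L_Z(c) = P(N_Z = c)`, `W_Z(s,t) = P(s ≤ N_Z ≤ t)`):
`indepEvents_real_insert` (convolution, arbitrary predicate); `indepEvents_window_insert`
(`W_{Z+z} − W_Z = p_z·(L_Z(s−1) − L_Z(t))`); `indepEvents_dom_of_lt` (a strict rise `L(s−1) < L(t)` forces `L(c−a) ≤ L(c)` on
`[a,t]`, `a = t+1−s`: largest strict rise + `indepEvents_law_mono_below_of_lt`); `indepEvents_dom_insert` (domination survives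
convolution — no log-concavity needed); `indepEvents_window_noRise`: for nested `Z ⊆ Z' ⊆ Z''`, `W_Z > W_{Z'} ⟹ W_{Z''} ≤ W_{Z'}`;
`indepEvents_window_zero_antitone` (`s = 0`).  Census: relocating ONE blob hair among unit hairs is valid in 7 000/7 000 exact
adversarial combs, and NOT valid for unit hairs next to blobs (explicit dips) — hence unit increments only.  Theorems only; no sorries.
[folklore: log-concavity of Poisson-binomial laws; window/nested-family form: this work] [cite: Grimmett1999, §2.2]
-/

noncomputable section

namespace Summit.CriticalPhenomena.PercolationContinuityZ3.Theorems

namespace Quant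

open Finset MeasureTheory
open Literature.Probability.LatticeModels
open Literature.Probability.Percolation
open scoped Classical

variable {ι κ : Type*} [Finite ι]

/-! ### Convolution with one more witness, arbitrary predicate -/

/-- **Convolution with one more witness (general predicate).**  If `z ∉ Z` and `Q z` is disjoint from every `Q w`, `w ∈ Z`,
then for every predicate `Φ` of the count, `P(Φ(N_{Z+z})) = p_z·P(Φ(N_Z + 1)) + (1 − p_z)·P(Φ(N_Z))`.
[folklore; independence of disjointly supported events] -/
theorem indepEvents_real_insert (q : ι → unitInterval) (Q : κ → Finset ι) (Z : Finset κ) {z : κ} (hz : z ∉ Z)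
    (hdisj : ∀ w ∈ Z, Disjoint (Q w) (Q z)) (Φ : ℕ → Prop) :
    (prodBernoulli q).real {ω : Set ι | Φ ((insert z Z).filter fun w => ((Q w : Finset ι) : Set ι) ⊆ ω).card} =
      (∏ i ∈ Q z, (q i : ℝ)) *
          (prodBernoulli q).real {ω : Set ι | Φ ((Z.filter fun w => ((Q w : Finset ι) : Set ι) ⊆ ω).card + 1)} +
        (1 - ∏ i ∈ Q z, (q i : ℝ)) *
          (prodBernoulli q).real {ω : Set ι | Φ ((Z.filter fun w => ((Q w : Finset ι) : Set ι) ⊆ ω).card)} := by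
  set μ := prodBernoulli q with hμ
  have hmeas : ∀ T : Set (Set ι), MeasurableSet T := fun T => (Set.toFinite T).measurableSet
  set O : Set (Set ι) := {ω | ((Q z : Finset ι) : Set ι) ⊆ ω} with hO
  set Em : Set (Set ι) := {ω | Φ ((Z.filter fun w => ((Q w : Finset ι) : Set ι) ⊆ ω).card + 1)} with hEm
  set Ec : Set (Set ι) := {ω | Φ ((Z.filter fun w => ((Q w : Finset ι) : Set ι) ⊆ ω).card)} with hEc
  have hsplit : {ω : Set ι | Φ ((insert z Z).filter fun w => ((Q w : Finset ι) : Set ι) ⊆ ω).card} =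
      (Em ∩ O) ∪ (Ec \ O) := by
    ext ω
    simp only [Set.mem_setOf_eq, Set.mem_union, Set.mem_inter_iff, Set.mem_sdiff, hEm, hEc, hO]
    rw [indepEvents_card_filter_insert Q Z hz ω]
    by_cases h : ((Q z : Finset ι) : Set ι) ⊆ ω
    · simp only [h, ↓reduceIte, and_true, not_true_eq_false, and_false, or_false]
    · simp only [h, ↓reduceIte, add_zero, and_false, not_false_eq_true, and_true, false_or]
  have hd : Disjoint (Em ∩ O) (Ec \ O) := Set.disjoint_left.2 fun ω h h' => h'.2 h.2
  set F : Finset ι := Z.biUnion Q with hF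
  have hFz : Disjoint F (Q z) := by rw [hF, Finset.disjoint_biUnion_left]; exact hdisj
  have hQF : ∀ w ∈ Z, Q w ⊆ F := fun w hw => Finset.subset_biUnion_of_mem Q hw
  have dO : DeterminedBy O (↑(Q z) : Set ι) := determinedBy_subset_open (Q z)
  have dE : ∀ Ψ : ℕ → Prop, DeterminedBy {ω : Set ι | Ψ ((Z.filter fun w => ((Q w : Finset ι) : Set ι) ⊆ ω).card)} (↑F : Set ι) :=
    fun Ψ => determinedBy_card_filter_open Z Q F hQF Ψ
  have p1 : μ.real (Em ∩ O) = μ.real Em * μ.real O :=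
    prodBernoulli_real_inter_of_determinedBy_disjoint q hFz (dE fun n => Φ (n + 1)) dO (hmeas _) (hmeas _)
  have p2 : μ.real (Ec ∩ O) = μ.real Ec * μ.real O :=
    prodBernoulli_real_inter_of_determinedBy_disjoint q hFz (dE fun n => Φ n) dO (hmeas _) (hmeas _)
  have p3 : μ.real (Ec ∩ O) + μ.real (Ec \ O) = μ.real Ec := measureReal_inter_add_sdiff (hmeas _)
  have hPO : μ.real O = ∏ i ∈ Q z, (q i : ℝ) := prodBernoulli_real_subset q (Q z)
  rw [hsplit, measureReal_union hd (hmeas _), p1, hPO]; rw [hPO] at p2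
  linarith [p2, p3]

/-! ### Windows: the telescoping step -/

omit [Finite ι] in
/-- Shifting a window down by one: `P(s ≤ N ≤ t) + P(N = t+1) = P(N = s) + P(s+1 ≤ N ≤ t+1)` (`s ≤ t + 1`). [folklore] -/
theorem real_window_shift {Ω : Type*} [MeasurableSpace Ω] (μ : Measure Ω) [IsFiniteMeasure μ] (N : Ω → ℕ)
    (hmeas : ∀ T : Set Ω, MeasurableSet T) {s t : ℕ} (hst : s ≤ t + 1) :
    μ.real {ω | s ≤ N ω ∧ N ω ≤ t} + μ.real {ω | N ω = t + 1} =
      μ.real {ω | N ω = s} + μ.real {ω | s + 1 ≤ N ω ∧ N ω ≤ t + 1} := by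
  have h1 : {ω | s ≤ N ω ∧ N ω ≤ t + 1} = {ω | s ≤ N ω ∧ N ω ≤ t} ∪ {ω | N ω = t + 1} := by
    ext ω; simp only [Set.mem_setOf_eq, Set.mem_union]; omega
  have d1 : Disjoint {ω | s ≤ N ω ∧ N ω ≤ t} {ω | N ω = t + 1} :=
    Set.disjoint_left.2 fun ω h h' => by simp only [Set.mem_setOf_eq] at h h'; omega
  have h2 : {ω | s ≤ N ω ∧ N ω ≤ t + 1} = {ω | N ω = s} ∪ {ω | s + 1 ≤ N ω ∧ N ω ≤ t + 1} := by
    ext ω; simp only [Set.mem_setOf_eq, Set.mem_union]; omega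
  have d2 : Disjoint {ω | N ω = s} {ω | s + 1 ≤ N ω ∧ N ω ≤ t + 1} :=
    Set.disjoint_left.2 fun ω h h' => by simp only [Set.mem_setOf_eq] at h h'; omega
  rw [← measureReal_union d1 (hmeas _), ← h1, h2, measureReal_union d2 (hmeas _)]

/-- **Window step.**  For `1 ≤ s ≤ t`, adding a disjointly supported witness `z ∉ Z` changes the window probability by
`W_{Z+z}(s,t) − W_Z(s,t) = p_z·(L_Z(s−1) − L_Z(t))` (telescoping of the convolution). [this work] -/
theorem indepEvents_window_insert (q : ι → unitInterval) (Q : κ → Finset ι) (Z : Finset κ) {z : κ} (hz : z ∉ Z)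
    (hdisj : ∀ w ∈ Z, Disjoint (Q w) (Q z)) {s t : ℕ} (hs : 1 ≤ s) (hst : s ≤ t) :
    (prodBernoulli q).real {ω : Set ι | s ≤ ((insert z Z).filter fun w => ((Q w : Finset ι) : Set ι) ⊆ ω).card ∧
        ((insert z Z).filter fun w => ((Q w : Finset ι) : Set ι) ⊆ ω).card ≤ t} =
      (prodBernoulli q).real {ω : Set ι | s ≤ (Z.filter fun w => ((Q w : Finset ι) : Set ι) ⊆ ω).card ∧
          (Z.filter fun w => ((Q w : Finset ι) : Set ι) ⊆ ω).card ≤ t} +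
        (∏ i ∈ Q z, (q i : ℝ)) *
          ((prodBernoulli q).real {ω : Set ι | (Z.filter fun w => ((Q w : Finset ι) : Set ι) ⊆ ω).card = s - 1} -
            (prodBernoulli q).real {ω : Set ι | (Z.filter fun w => ((Q w : Finset ι) : Set ι) ⊆ ω).card = t}) := by
  set μ := prodBernoulli q with hμ
  set N : Set ι → ℕ := fun ω => (Z.filter fun w => ((Q w : Finset ι) : Set ι) ⊆ ω).card with hN
  have hmeas : ∀ T : Set (Set ι), MeasurableSet T := fun T => (Set.toFinite T).measurableSet
  set p : ℝ := ∏ i ∈ Q z, (q i : ℝ) with hp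
  have h1 := indepEvents_real_insert q Q Z hz hdisj (fun n => s ≤ n ∧ n ≤ t)
  rw [h1]
  -- `{s ≤ N+1 ≤ t} = {s-1 ≤ N ≤ t-1}`
  obtain ⟨s', rfl⟩ : ∃ s', s = s' + 1 := ⟨s - 1, by omega⟩
  obtain ⟨t', rfl⟩ : ∃ t', t = t' + 1 := ⟨t - 1, by omega⟩
  have hshift : {ω : Set ι | s' + 1 ≤ N ω + 1 ∧ N ω + 1 ≤ t' + 1} = {ω | s' ≤ N ω ∧ N ω ≤ t'} := by
    ext ω; simp only [Set.mem_setOf_eq]; omega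
  have hsw := real_window_shift μ N hmeas (s := s') (t := t') (by omega)
  simp only [Nat.add_sub_cancel]
  show p * μ.real {ω : Set ι | s' + 1 ≤ N ω + 1 ∧ N ω + 1 ≤ t' + 1} + (1 - p) * μ.real {ω | s' + 1 ≤ N ω ∧ N ω ≤ t' + 1} =
    μ.real {ω | s' + 1 ≤ N ω ∧ N ω ≤ t' + 1} + p * (μ.real {ω | N ω = s'} - μ.real {ω | N ω = t' + 1})
  rw [hshift]
  have hsw' : μ.real {ω | s' ≤ N ω ∧ N ω ≤ t'} =
      μ.real {ω | N ω = s'} + μ.real {ω | s' + 1 ≤ N ω ∧ N ω ≤ t' + 1} - μ.real {ω | N ω = t' + 1} := by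
    linarith [hsw]
  rw [hsw']
  ring

/-! ### The domination invariant `L(c − a) ≤ L(c)` on `[a, t]` -/

omit [Finite ι] in
/-- Monotone on a prefix: from `f c ≤ f (c+1)` for all `c < n` to `f x ≤ f y` for `x ≤ y ≤ n`. [folklore] -/
theorem mono_prefix_of_le_succ (f : ℕ → ℝ) {n : ℕ} (h : ∀ c, c < n → f c ≤ f (c + 1)) :
    ∀ x y, x ≤ y → y ≤ n → f x ≤ f y := by
  intro x y hxy hyn
  induction y with
  | zero => rw [Nat.le_zero.1 hxy]
  | succ y ih =>
    rcases Nat.lt_or_ge x (y + 1) with hlt | hge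
    · exact (ih (by omega) (by omega)).trans (h y (by omega))
    · rw [le_antisymm hxy hge]

omit [Finite ι] in
/-- Antitone on a segment: from `f (c+1) ≤ f c` for all `m ≤ c < n` to `f y ≤ f x` for `m ≤ x ≤ y ≤ n`. [folklore] -/
theorem anti_segment_of_succ_le (f : ℕ → ℝ) {m n : ℕ} (h : ∀ c, m ≤ c → c < n → f (c + 1) ≤ f c) :
    ∀ x y, m ≤ x → x ≤ y → y ≤ n → f y ≤ f x := by
  intro x y hmx hxy hyn
  induction y with
  | zero => rw [Nat.le_zero.1 hxy]
  | succ y ih =>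
    rcases Nat.lt_or_ge x (y + 1) with hlt | hge
    · exact (h y (by omega) (by omega)).trans (ih (by omega) (by omega))
    · rw [le_antisymm hxy hge]

/-- **A strict window rise forces domination** (unimodality of Poisson-binomial laws).  For pairwise disjoint gate sets and
`1 ≤ s ≤ t`: if `L_Z(s−1) < L_Z(t)` then `L_Z(c − a) ≤ L_Z(c)` for all `a ≤ c ≤ t`, where `a = t + 1 − s`.
Proof: take the largest `r < t` with `L(r) < L(r+1)` (one exists in `[s−1, t)`); `L` is non-decreasing on `[0, r+1]`
(`indepEvents_law_mono_below_of_lt`) and non-increasing on `[r+1, t]`. [this work] -/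
theorem indepEvents_dom_of_lt (q : ι → unitInterval) (Q : κ → Finset ι) (Z : Finset κ)
    (hdisj : ∀ w ∈ Z, ∀ w' ∈ Z, w ≠ w' → Disjoint (Q w) (Q w')) {s t : ℕ} (hs : 1 ≤ s) (hst : s ≤ t)
    (hlt : (prodBernoulli q).real {ω : Set ι | (Z.filter fun w => ((Q w : Finset ι) : Set ι) ⊆ ω).card = s - 1} <
      (prodBernoulli q).real {ω : Set ι | (Z.filter fun w => ((Q w : Finset ι) : Set ι) ⊆ ω).card = t}) :
    ∀ c, t + 1 - s ≤ c → c ≤ t →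
      (prodBernoulli q).real {ω : Set ι | (Z.filter fun w => ((Q w : Finset ι) : Set ι) ⊆ ω).card = c - (t + 1 - s)} ≤
        (prodBernoulli q).real {ω : Set ι | (Z.filter fun w => ((Q w : Finset ι) : Set ι) ⊆ ω).card = c} := by
  set L : ℕ → ℝ := fun c => (prodBernoulli q).real {ω : Set ι | (Z.filter fun w => ((Q w : Finset ι) : Set ι) ⊆ ω).card = c}
    with hL
  have hlt' : L (s - 1) < L t := hlt
  intro c hac hct
  show L (c - (t + 1 - s)) ≤ L c
  have hex : ∃ r, s - 1 ≤ r ∧ r < t ∧ L r < L (r + 1) := by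
    by_contra hno
    push Not at hno
    have hanti := anti_segment_of_succ_le L (m := s - 1) (n := t) (fun c hmc hcn => hno c hmc hcn)
    have := hanti (s - 1) t le_rfl (by omega) le_rfl
    exact absurd hlt' (not_lt.2 this)
  set r := Nat.findGreatest (fun r => L r < L (r + 1)) (t - 1) with hr
  obtain ⟨r₀, hr₀s, hr₀t, hr₀lt⟩ := hex
  have hPr : L r < L (r + 1) := by
    have := Nat.findGreatest_spec (P := fun r => L r < L (r + 1)) (m := r₀) (n := t - 1) (by omega) hr₀lt
    exact this
  have hr₀le : r₀ ≤ r := Nat.le_findGreatest (P := fun r => L r < L (r + 1)) (by omega) hr₀lt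
  have hrt : r ≤ t - 1 := Nat.findGreatest_le (t - 1)
  have hnorise : ∀ k, r + 1 ≤ k → k < t → L (k + 1) ≤ L k := by
    intro k hk1 hk2
    have hk : ¬ (L k < L (k + 1)) :=
      Nat.findGreatest_is_greatest (P := fun r => L r < L (r + 1)) (by omega : r < k) (by omega : k ≤ t - 1)
    exact not_lt.1 hk
  have hmono : ∀ x y, x ≤ y → y ≤ r + 1 → L x ≤ L y :=
    mono_prefix_of_le_succ L (n := r + 1) fun c hc => indepEvents_law_mono_below_of_lt q Q Z hdisj hPr c (by omega)
  have hanti : ∀ x y, r + 1 ≤ x → x ≤ y → y ≤ t → L y ≤ L x := anti_segment_of_succ_le L hnorise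
  rcases Nat.lt_or_ge (r + 1) c with hc | hc
  · -- c beyond the peak: L(c - a) ≤ L(s-1) < L(t) ≤ L(c)
    have h1 : L (c - (t + 1 - s)) ≤ L (s - 1) := hmono _ _ (by omega) (by omega)
    have h2 : L t ≤ L c := hanti c t (by omega) hct le_rfl
    linarith
  · exact hmono _ _ (by omega) hc

/-- **Domination survives convolution with one more witness** (no log-concavity needed): if `L_Z(c − a) ≤ L_Z(c)` for all
`a ≤ c ≤ t` then the same holds for `L_{Z+z}`. [this work] -/
theorem indepEvents_dom_insert (q : ι → unitInterval) (Q : κ → Finset ι) (Z : Finset κ) {z : κ} (hz : z ∉ Z)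
    (hdisj : ∀ w ∈ Z, Disjoint (Q w) (Q z)) {a t : ℕ} (ha : 1 ≤ a)
    (hdom : ∀ c, a ≤ c → c ≤ t →
      (prodBernoulli q).real {ω : Set ι | (Z.filter fun w => ((Q w : Finset ι) : Set ι) ⊆ ω).card = c - a} ≤
        (prodBernoulli q).real {ω : Set ι | (Z.filter fun w => ((Q w : Finset ι) : Set ι) ⊆ ω).card = c}) :
    ∀ c, a ≤ c → c ≤ t →
      (prodBernoulli q).real {ω : Set ι | ((insert z Z).filter fun w => ((Q w : Finset ι) : Set ι) ⊆ ω).card = c - a} ≤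
        (prodBernoulli q).real {ω : Set ι | ((insert z Z).filter fun w => ((Q w : Finset ι) : Set ι) ⊆ ω).card = c} := by
  set L : ℕ → ℝ := fun c => (prodBernoulli q).real {ω : Set ι | (Z.filter fun w => ((Q w : Finset ι) : Set ι) ⊆ ω).card = c}
    with hL
  set p : ℝ := ∏ i ∈ Q z, (q i : ℝ) with hp
  have hp0 : 0 ≤ p := Finset.prod_nonneg fun i _ => (q i).2.1
  have hp1 : p ≤ 1 := Finset.prod_le_one (fun i _ => (q i).2.1) fun i _ => (q i).2.2
  have hL0 : ∀ c, 0 ≤ L c := fun c => measureReal_nonneg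
  have hdom' : ∀ c, a ≤ c → c ≤ t → L (c - a) ≤ L c := hdom
  intro c hac hct
  obtain ⟨c', rfl⟩ : ∃ c', c = c' + 1 := ⟨c - 1, by omega⟩
  rw [indepEvents_law_insert_succ q Q Z hz hdisj c']
  rcases Nat.lt_or_ge a (c' + 1) with hlt | hge
  · -- c' + 1 - a = (c' - a) + 1 ≥ 1
    have e : c' + 1 - a = (c' - a) + 1 := by omega
    rw [e, indepEvents_law_insert_succ q Q Z hz hdisj (c' - a)]
    have h1 : L (c' - a) ≤ L c' := by
      have := hdom' c' (by omega) (by omega); rwa [show c' - a = c' - a from rfl] at this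
    have h2 : L (c' - a + 1) ≤ L (c' + 1) := by
      have := hdom' (c' + 1) hac hct; rwa [e] at this
    show p * L (c' - a) + (1 - p) * L (c' - a + 1) ≤ p * L c' + (1 - p) * L (c' + 1)
    nlinarith [mul_le_mul_of_nonneg_left h1 hp0, mul_le_mul_of_nonneg_left h2 (sub_nonneg.2 hp1)]
  · -- c' + 1 = a: the new law at 0
    have e : c' + 1 - a = 0 := by omega
    rw [e, indepEvents_law_insert_zero q Q Z hz hdisj]
    have h2 : L 0 ≤ L (c' + 1) := by
      have := hdom' (c' + 1) hac hct; rwa [e] at this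
    show (1 - p) * L 0 ≤ p * L c' + (1 - p) * L (c' + 1)
    nlinarith [mul_le_mul_of_nonneg_left h2 (sub_nonneg.2 hp1), mul_nonneg hp0 (hL0 c')]

/-- Under domination on `[a, t]` with `a = t + 1 − s`, adding a witness cannot raise the window `W(s,t)`:
`W_{Z+z}(s,t) ≤ W_Z(s,t)`. [this work] -/
theorem indepEvents_window_le_of_dom (q : ι → unitInterval) (Q : κ → Finset ι) (Z : Finset κ) {z : κ} (hz : z ∉ Z)
    (hdisj : ∀ w ∈ Z, Disjoint (Q w) (Q z)) {s t : ℕ} (hs : 1 ≤ s) (hst : s ≤ t)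
    (hdom : ∀ c, t + 1 - s ≤ c → c ≤ t →
      (prodBernoulli q).real {ω : Set ι | (Z.filter fun w => ((Q w : Finset ι) : Set ι) ⊆ ω).card = c - (t + 1 - s)} ≤
        (prodBernoulli q).real {ω : Set ι | (Z.filter fun w => ((Q w : Finset ι) : Set ι) ⊆ ω).card = c}) :
    (prodBernoulli q).real {ω : Set ι | s ≤ ((insert z Z).filter fun w => ((Q w : Finset ι) : Set ι) ⊆ ω).card ∧
        ((insert z Z).filter fun w => ((Q w : Finset ι) : Set ι) ⊆ ω).card ≤ t} ≤
      (prodBernoulli q).real {ω : Set ι | s ≤ (Z.filter fun w => ((Q w : Finset ι) : Set ι) ⊆ ω).card ∧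
          (Z.filter fun w => ((Q w : Finset ι) : Set ι) ⊆ ω).card ≤ t} := by
  rw [indepEvents_window_insert q Q Z hz hdisj hs hst]
  have hp0 : 0 ≤ ∏ i ∈ Q z, (q i : ℝ) := Finset.prod_nonneg fun i _ => (q i).2.1
  have h := hdom t (by omega) le_rfl
  rw [show t - (t + 1 - s) = s - 1 by omega] at h
  nlinarith [mul_nonneg hp0 (sub_nonneg.2 h)]

/-- A strict window fall `W_{Z+z}(s,t) < W_Z(s,t)` forces domination for `L_Z` on `[a, t]` (hence, by
`indepEvents_dom_insert`, for `L_{Z+z}` as well). [this work] -/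
theorem indepEvents_dom_of_fall (q : ι → unitInterval) (Q : κ → Finset ι) (Z : Finset κ) {z : κ} (hz : z ∉ Z)
    (hdisj : ∀ w ∈ insert z Z, ∀ w' ∈ insert z Z, w ≠ w' → Disjoint (Q w) (Q w')) {s t : ℕ} (hs : 1 ≤ s) (hst : s ≤ t)
    (hfall : (prodBernoulli q).real {ω : Set ι | s ≤ ((insert z Z).filter fun w => ((Q w : Finset ι) : Set ι) ⊆ ω).card ∧
        ((insert z Z).filter fun w => ((Q w : Finset ι) : Set ι) ⊆ ω).card ≤ t} <
      (prodBernoulli q).real {ω : Set ι | s ≤ (Z.filter fun w => ((Q w : Finset ι) : Set ι) ⊆ ω).card ∧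
          (Z.filter fun w => ((Q w : Finset ι) : Set ι) ⊆ ω).card ≤ t}) :
    ∀ c, t + 1 - s ≤ c → c ≤ t →
      (prodBernoulli q).real {ω : Set ι | (Z.filter fun w => ((Q w : Finset ι) : Set ι) ⊆ ω).card = c - (t + 1 - s)} ≤
        (prodBernoulli q).real {ω : Set ι | (Z.filter fun w => ((Q w : Finset ι) : Set ι) ⊆ ω).card = c} := by
  have hdZ : ∀ w ∈ Z, ∀ w' ∈ Z, w ≠ w' → Disjoint (Q w) (Q w') := fun w hw w' hw' hne =>
    hdisj w (Finset.mem_insert_of_mem hw) w' (Finset.mem_insert_of_mem hw') hne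
  have hdz : ∀ w ∈ Z, Disjoint (Q w) (Q z) := fun w hw =>
    hdisj w (Finset.mem_insert_of_mem hw) z (Finset.mem_insert_self z Z) (fun h => hz (h ▸ hw))
  rw [indepEvents_window_insert q Q Z hz hdz hs hst] at hfall
  have hp0 : 0 ≤ ∏ i ∈ Q z, (q i : ℝ) := Finset.prod_nonneg fun i _ => (q i).2.1
  have hlt : (prodBernoulli q).real {ω : Set ι | (Z.filter fun w => ((Q w : Finset ι) : Set ι) ⊆ ω).card = s - 1} <
      (prodBernoulli q).real {ω : Set ι | (Z.filter fun w => ((Q w : Finset ι) : Set ι) ⊆ ω).card = t} := by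
    by_contra hge
    push Not at hge
    have : 0 ≤ (∏ i ∈ Q z, (q i : ℝ)) *
        ((prodBernoulli q).real {ω : Set ι | (Z.filter fun w => ((Q w : Finset ι) : Set ι) ⊆ ω).card = s - 1} -
          (prodBernoulli q).real {ω : Set ι | (Z.filter fun w => ((Q w : Finset ι) : Set ι) ⊆ ω).card = t}) :=
      mul_nonneg hp0 (sub_nonneg.2 hge)
    linarith
  exact indepEvents_dom_of_lt q Q Z hdZ hs hst hlt

/-- Domination propagates along any extension of the family, and the window never rises again. [this work] -/
theorem indepEvents_window_le_of_dom_union (q : ι → unitInterval) (Q : κ → Finset ι) (Z D : Finset κ)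
    (hdisj : ∀ w ∈ Z ∪ D, ∀ w' ∈ Z ∪ D, w ≠ w' → Disjoint (Q w) (Q w')) {s t : ℕ} (hs : 1 ≤ s) (hst : s ≤ t)
    (hdom : ∀ c, t + 1 - s ≤ c → c ≤ t →
      (prodBernoulli q).real {ω : Set ι | (Z.filter fun w => ((Q w : Finset ι) : Set ι) ⊆ ω).card = c - (t + 1 - s)} ≤
        (prodBernoulli q).real {ω : Set ι | (Z.filter fun w => ((Q w : Finset ι) : Set ι) ⊆ ω).card = c}) :
    (∀ c, t + 1 - s ≤ c → c ≤ t →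
      (prodBernoulli q).real {ω : Set ι | ((Z ∪ D).filter fun w => ((Q w : Finset ι) : Set ι) ⊆ ω).card = c - (t + 1 - s)} ≤
        (prodBernoulli q).real {ω : Set ι | ((Z ∪ D).filter fun w => ((Q w : Finset ι) : Set ι) ⊆ ω).card = c}) ∧
    (prodBernoulli q).real {ω : Set ι | s ≤ ((Z ∪ D).filter fun w => ((Q w : Finset ι) : Set ι) ⊆ ω).card ∧
        ((Z ∪ D).filter fun w => ((Q w : Finset ι) : Set ι) ⊆ ω).card ≤ t} ≤
      (prodBernoulli q).real {ω : Set ι | s ≤ (Z.filter fun w => ((Q w : Finset ι) : Set ι) ⊆ ω).card ∧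
          (Z.filter fun w => ((Q w : Finset ι) : Set ι) ⊆ ω).card ≤ t} := by
  induction D using Finset.induction_on with
  | empty => simp only [Finset.union_empty]; exact ⟨hdom, le_rfl⟩
  | @insert z D hzD ih =>
    have hsub : Z ∪ D ⊆ Z ∪ insert z D := Finset.union_subset_union le_rfl (Finset.subset_insert z D)
    have hd' : ∀ w ∈ Z ∪ D, ∀ w' ∈ Z ∪ D, w ≠ w' → Disjoint (Q w) (Q w') := fun w hw w' hw' hne =>
      hdisj w (hsub hw) w' (hsub hw') hne
    obtain ⟨hm, hle⟩ := ih hd'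
    by_cases hzZ : z ∈ Z ∪ D
    · have : Z ∪ insert z D = Z ∪ D := by
        rw [Finset.union_insert, Finset.insert_eq_of_mem hzZ]
      rw [this]; exact ⟨hm, hle⟩
    · have heq : Z ∪ insert z D = insert z (Z ∪ D) := Finset.union_insert z Z D
      have hz' : z ∈ Z ∪ insert z D := Finset.mem_union_right Z (Finset.mem_insert_self z D)
      have hdz : ∀ w ∈ Z ∪ D, Disjoint (Q w) (Q z) := fun w hw =>
        hdisj w (hsub hw) z hz' (fun h => hzZ (h ▸ hw))
      rw [heq]
      exact ⟨indepEvents_dom_insert q Q (Z ∪ D) hzZ hdz (by omega) hm,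
        (indepEvents_window_le_of_dom q Q (Z ∪ D) hzZ hdz hs hst hm).trans hle⟩

/-- Along an extension `Z ⊆ Z ∪ D`, either the window `W(s,t)` has not fallen, or domination holds at the end. [this work] -/
theorem indepEvents_window_ge_or_dom_union (q : ι → unitInterval) (Q : κ → Finset ι) (Z D : Finset κ)
    (hdisj : ∀ w ∈ Z ∪ D, ∀ w' ∈ Z ∪ D, w ≠ w' → Disjoint (Q w) (Q w')) {s t : ℕ} (hs : 1 ≤ s) (hst : s ≤ t) :
    (prodBernoulli q).real {ω : Set ι | s ≤ (Z.filter fun w => ((Q w : Finset ι) : Set ι) ⊆ ω).card ∧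
          (Z.filter fun w => ((Q w : Finset ι) : Set ι) ⊆ ω).card ≤ t} ≤
        (prodBernoulli q).real {ω : Set ι | s ≤ ((Z ∪ D).filter fun w => ((Q w : Finset ι) : Set ι) ⊆ ω).card ∧
          ((Z ∪ D).filter fun w => ((Q w : Finset ι) : Set ι) ⊆ ω).card ≤ t} ∨
      ∀ c, t + 1 - s ≤ c → c ≤ t →
        (prodBernoulli q).real {ω : Set ι | ((Z ∪ D).filter fun w => ((Q w : Finset ι) : Set ι) ⊆ ω).card = c - (t + 1 - s)} ≤
          (prodBernoulli q).real {ω : Set ι | ((Z ∪ D).filter fun w => ((Q w : Finset ι) : Set ι) ⊆ ω).card = c} := by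
  induction D using Finset.induction_on with
  | empty => left; simp only [Finset.union_empty]; exact le_rfl
  | @insert z D hzD ih =>
    have hsub : Z ∪ D ⊆ Z ∪ insert z D := Finset.union_subset_union le_rfl (Finset.subset_insert z D)
    have hd' : ∀ w ∈ Z ∪ D, ∀ w' ∈ Z ∪ D, w ≠ w' → Disjoint (Q w) (Q w') := fun w hw w' hw' hne =>
      hdisj w (hsub hw) w' (hsub hw') hne
    by_cases hzZ : z ∈ Z ∪ D
    · have : Z ∪ insert z D = Z ∪ D := by
        rw [Finset.union_insert, Finset.insert_eq_of_mem hzZ]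
      rw [this]; exact ih hd'
    · have heq : Z ∪ insert z D = insert z (Z ∪ D) := Finset.union_insert z Z D
      have hz' : z ∈ Z ∪ insert z D := Finset.mem_union_right Z (Finset.mem_insert_self z D)
      have hdz : ∀ w ∈ Z ∪ D, Disjoint (Q w) (Q z) := fun w hw =>
        hdisj w (hsub hw) z hz' (fun h => hzZ (h ▸ hw))
      have hdi : ∀ w ∈ insert z (Z ∪ D), ∀ w' ∈ insert z (Z ∪ D), w ≠ w' → Disjoint (Q w) (Q w') := by
        rw [← heq]; exact hdisj
      rw [heq]
      rcases ih hd' with hge | hm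
      · by_cases hstep : (prodBernoulli q).real {ω : Set ι |
              s ≤ ((insert z (Z ∪ D)).filter fun w => ((Q w : Finset ι) : Set ι) ⊆ ω).card ∧
              ((insert z (Z ∪ D)).filter fun w => ((Q w : Finset ι) : Set ι) ⊆ ω).card ≤ t} <
            (prodBernoulli q).real {ω : Set ι | s ≤ ((Z ∪ D).filter fun w => ((Q w : Finset ι) : Set ι) ⊆ ω).card ∧
              ((Z ∪ D).filter fun w => ((Q w : Finset ι) : Set ι) ⊆ ω).card ≤ t}
        · right
          have hmZD := indepEvents_dom_of_fall q Q (Z ∪ D) hzZ hdi hs hst hstep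
          exact indepEvents_dom_insert q Q (Z ∪ D) hzZ hdz (by omega) hmZD
        · left; push Not at hstep; exact hge.trans hstep
      · right
        exact indepEvents_dom_insert q Q (Z ∪ D) hzZ hdz (by omega) hm

/-- **No rise after a fall, window form.**  For nested families `Z ⊆ Z' ⊆ Z''` inside a pairwise-disjoint family of gate
sets and a window `1 ≤ s ≤ t`: if `W_Z(s,t) > W_{Z'}(s,t)` then `W_{Z''}(s,t) ≤ W_{Z'}(s,t)` — once `P(s ≤ count ≤ t)` has
strictly decreased along a growing family of independent events, it never increases again (unimodality of
`k ↦ P(C_k ∈ [s,t])`; the blob-hair analogue of `indepEvents_law_noRise`, which is the case `s = t`). [this work] -/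
theorem indepEvents_window_noRise (q : ι → unitInterval) (Q : κ → Finset ι) (Z Z' Z'' : Finset κ) (h1 : Z ⊆ Z')
    (h2 : Z' ⊆ Z'') (hdisj : ∀ w ∈ Z'', ∀ w' ∈ Z'', w ≠ w' → Disjoint (Q w) (Q w')) {s t : ℕ} (hs : 1 ≤ s) (hst : s ≤ t)
    (hfall : (prodBernoulli q).real {ω : Set ι | s ≤ (Z'.filter fun w => ((Q w : Finset ι) : Set ι) ⊆ ω).card ∧
        (Z'.filter fun w => ((Q w : Finset ι) : Set ι) ⊆ ω).card ≤ t} <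
      (prodBernoulli q).real {ω : Set ι | s ≤ (Z.filter fun w => ((Q w : Finset ι) : Set ι) ⊆ ω).card ∧
          (Z.filter fun w => ((Q w : Finset ι) : Set ι) ⊆ ω).card ≤ t}) :
    (prodBernoulli q).real {ω : Set ι | s ≤ (Z''.filter fun w => ((Q w : Finset ι) : Set ι) ⊆ ω).card ∧
        (Z''.filter fun w => ((Q w : Finset ι) : Set ι) ⊆ ω).card ≤ t} ≤
      (prodBernoulli q).real {ω : Set ι | s ≤ (Z'.filter fun w => ((Q w : Finset ι) : Set ι) ⊆ ω).card ∧
          (Z'.filter fun w => ((Q w : Finset ι) : Set ι) ⊆ ω).card ≤ t} := by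
  have hZ' : Z ∪ (Z' \ Z) = Z' := Finset.union_sdiff_of_subset h1
  have hZ'' : Z' ∪ (Z'' \ Z') = Z'' := Finset.union_sdiff_of_subset h2
  have hd1 : ∀ w ∈ Z ∪ (Z' \ Z), ∀ w' ∈ Z ∪ (Z' \ Z), w ≠ w' → Disjoint (Q w) (Q w') := by
    rw [hZ']; exact fun w hw w' hw' hne => hdisj w (h2 hw) w' (h2 hw') hne
  have hd2 : ∀ w ∈ Z' ∪ (Z'' \ Z'), ∀ w' ∈ Z' ∪ (Z'' \ Z'), w ≠ w' → Disjoint (Q w) (Q w') := by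
    rw [hZ'']; exact hdisj
  have hdom : ∀ c, t + 1 - s ≤ c → c ≤ t →
      (prodBernoulli q).real {ω : Set ι | (Z'.filter fun w => ((Q w : Finset ι) : Set ι) ⊆ ω).card = c - (t + 1 - s)} ≤
        (prodBernoulli q).real {ω : Set ι | (Z'.filter fun w => ((Q w : Finset ι) : Set ι) ⊆ ω).card = c} := by
    have h := indepEvents_window_ge_or_dom_union q Q Z (Z' \ Z) hd1 hs hst
    rw [hZ'] at h
    rcases h with hge | hm
    · exact absurd hfall (not_lt.2 hge)
    · exact hm
  have h := (indepEvents_window_le_of_dom_union q Q Z' (Z'' \ Z') hd2 hs hst hdom).2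
  rwa [hZ''] at h

omit [Finite ι] in
/-- The window starting at `0` is the lower tail `P(count ≤ t)`, which is antitone along ANY growing family (the count
only grows): `Z ⊆ Z' ⟹ P(#_{Z'} ≤ t) ≤ P(#_Z ≤ t)`. [folklore] -/
theorem indepEvents_window_zero_antitone (q : ι → unitInterval) (Q : κ → Finset ι) (Z Z' : Finset κ) (h : Z ⊆ Z') (t : ℕ) :
    (prodBernoulli q).real {ω : Set ι | (Z'.filter fun w => ((Q w : Finset ι) : Set ι) ⊆ ω).card ≤ t} ≤
      (prodBernoulli q).real {ω : Set ι | (Z.filter fun w => ((Q w : Finset ι) : Set ι) ⊆ ω).card ≤ t} := by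
  refine measureReal_mono (fun ω hω => ?_) (measure_ne_top _ _)
  simp only [Set.mem_setOf_eq] at hω ⊢
  exact (Finset.card_le_card (Finset.filter_subset_filter _ h)).trans hω

end Quant

end Summit.CriticalPhenomena.PercolationContinuityZ3.Theorems

end
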